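import Literature.NumberTheory.GaloisRepresentations.GaloisCohomologyKummerProofs
import HarnessLib

/-!
# Compatible trivialisations `log_k : μ_{p^k}(K̄) ≃ ℤ/p^k` along the `p`-power tower (proofs)

`Proofs` file (theorems only; no definition, no named fact, no instance) in topic
`NumberTheory/GaloisRepresentations`, in the vocabulary of the tree's discrete Galois module `μₙ`
(`DiscreteGaloisModule.mu K n` on `MuCarrier K n = Additive μₙ(K̄)`, `muVal`, `cyclotomicCharacterModPow`).

For a field `K` and a prime `p` invertible in `K`, there is a COMPATIBLE system of primitive `p^k`-th roots of
unity `ζ_k ∈ K̄` (`ζ_0 = 1`, `ζ_{k+1}^p = ζ_k`; `exists_compatible_isPrimitiveRoot`), and along it a family of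
additive bijections ("discrete logarithms")

  `log_k : μ_{p^k}(K̄) → ℤ/p^k`,  `log_k (ζ_k^i) = i`,

which are `Γ_K`-EQUIVARIANT for the mod-`p^k` cyclotomic character, `log_k (σ ξ) = χ̄_k(σ) · log_k ξ`
(`σ ζ = ζ^{χ(σ)}`, the tree's `GaloisRep.cyclotomicCharacter_spec`), and COMPATIBLE with the `p`-th power maps
`μ_{p^{k+1}} → μ_{p^k}` and the reductions `ℤ/p^{k+1} → ℤ/p^k`:
`ξ' = ξ^p ⟹ log_k ξ' = (log_{k+1} ξ mod p^k)` (`exists_compatible_muLog`).  This is the choice of a generator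
of `ℤ_p(1) = lim_k μ_{p^k}` read at finite levels; it is the input that makes the `ℤ/p^k`-valued forms
`ẽ_k(a, b) = log_k e_k(a, τ b)` attached to a compatible family of Weil pairings (`conjPairing`, Howard 2004,
Rem. 1.3.2) compatible under reduction (the `e_red` clause of the cell's `DVRSetting.SatisfiesH`).

* §1 `exists_isPrimitiveRoot_pow_eq_of_prime`: a primitive `p^k`-th root has a primitive `p^{k+1}`-th root as a
  `p`-th root; `exists_compatible_isPrimitiveRoot`: the compatible system (dependent choice).
* §2 `exists_muLog_of_isPrimitiveRoot`: ONE level — a bijective `log : MuCarrier K n →+ ZMod n` with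
  `muVal v = ζ^i ⟹ log v = i` (Mathlib's `IsPrimitiveRoot.zmodEquivZPowers` and `zpowers_eq`), and its
  equivariance `muLog_equivariant_of_spec`.
* §3 `exists_compatible_muLog`: the family (bijective, equivariant, compatible).

References: [SerreGaloisCohomology1997] J.-P. Serre, *Galois Cohomology* (1997), Ch. II §1.2 (`μₙ`, `ℤ_p(1)`);
[NeukirchSchmidtWingberg2008] (7.3.6) `ℤ_p(1) = lim μ_{p^k}`; [Howard2004HeegnerKolyvagin] B. Howard, Compositio
Math. 140 (2004), Rem. 1.3.2 (the pairing `(s,t) = e(s, t^τ)` with values in `ℤ_p(1)`).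
-/

noncomputable section

open Field

universe u

namespace Literature.NumberTheory.GaloisRepresentations

open DiscreteGaloisModule

/-! ## §1 Compatible primitive `p^k`-th roots of unity -/

section Roots

variable {L : Type u} [Field L] [IsAlgClosed L] {p : ℕ} [hp : Fact p.Prime]

/-- In an algebraically closed field in which `p ≠ 0`, a primitive `p^k`-th root of unity `t` has a `p`-th root
which is a primitive `p^{k+1}`-th root of unity (for `k = 0`, `t = 1` and any primitive `p`-th root works).
[cite: SerreGaloisCohomology1997, Ch. II §1.2] -/
theorem exists_isPrimitiveRoot_pow_eq_of_prime (hpL : (p : L) ≠ 0) (k : ℕ) (t : L)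
    (ht : IsPrimitiveRoot t (p ^ k)) : ∃ y : L, IsPrimitiveRoot y (p ^ (k + 1)) ∧ y ^ p = t := by
  have hpp := hp.out
  rcases Nat.eq_zero_or_pos k with rfl | hk
  · -- `t = 1`: take any primitive `p`-th root
    rw [pow_zero, IsPrimitiveRoot.one_right_iff] at ht
    subst ht
    haveI : NeZero ((p ^ 1 : ℕ) : L) := ⟨by rw [pow_one]; exact hpL⟩
    obtain ⟨y, hy⟩ := HasEnoughRootsOfUnity.exists_primitiveRoot L (p ^ 1)
    exact ⟨y, by simpa using hy, by simpa using hy.pow_eq_one⟩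
  · obtain ⟨y, hy⟩ := IsAlgClosed.exists_pow_nat_eq t hpp.pos
    refine ⟨y, ?_, hy⟩
    have hnot : ¬ y ^ p ^ k = 1 := by
      obtain ⟨j, rfl⟩ : ∃ j, k = j + 1 := ⟨k - 1, by omega⟩
      rw [pow_succ', pow_mul, hy, ht.pow_eq_one_iff_dvd]
      intro hdvd
      exact absurd (Nat.le_of_dvd (pow_pos hpp.pos _) hdvd)
        (not_le.mpr (Nat.pow_lt_pow_right hpp.one_lt (by omega)))
    have hfin : y ^ p ^ (k + 1) = 1 := by
      rw [pow_succ', pow_mul, hy, ht.pow_eq_one]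
    have hord := orderOf_eq_prime_pow hnot hfin
    have := IsPrimitiveRoot.orderOf y
    rwa [hord] at this

/-- **A compatible system of primitive `p^k`-th roots of unity** in an algebraically closed field with `p ≠ 0`:
`ζ_0 = 1`, `ζ_k` primitive of order `p^k`, `ζ_{k+1}^p = ζ_k` (a generator of `ℤ_p(1) = lim_k μ_{p^k}`).
[cite: NeukirchSchmidtWingberg2008, (7.3.6)] -/
theorem exists_compatible_isPrimitiveRoot (hpL : (p : L) ≠ 0) :
    ∃ ζ : ℕ → L, (∀ k, IsPrimitiveRoot (ζ k) (p ^ k)) ∧ ∀ k, ζ (k + 1) ^ p = ζ k := by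
  choose f hfprim hfp using exists_isPrimitiveRoot_pow_eq_of_prime (L := L) hpL
  let T : ℕ → Type u := fun k ↦ {t : L // IsPrimitiveRoot t (p ^ k)}
  let seq : ∀ k, T k := fun k ↦ Nat.rec (motive := T) ⟨1, by simp⟩
    (fun k tk ↦ ⟨f k tk.1 tk.2, hfprim k tk.1 tk.2⟩) k
  exact ⟨fun k ↦ (seq k).1, fun k ↦ (seq k).2, fun k ↦ hfp k (seq k).1 (seq k).2⟩

end Roots

/-! ## §2 One level: the discrete logarithm attached to a primitive root -/

section OneLevel

variable (K : Type u) [Field K] {n : ℕ} [NeZero n]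

/-- **The discrete logarithm to the base `ζ`**: for a primitive `n`-th root of unity `ζ ∈ K̄` there is an additive
BIJECTION `log : μₙ(K̄) → ℤ/n` with `log ξ = i` whenever `ξ = ζ^i` (Mathlib's `IsPrimitiveRoot.zmodEquivZPowers`
composed with `zpowers ζ = μₙ`). [cite: SerreGaloisCohomology1997, Ch. II §1.2] -/
theorem exists_muLog_of_isPrimitiveRoot {ζ : (AlgebraicClosure K)ˣ} (hζ : IsPrimitiveRoot ζ n) :
    ∃ log : MuCarrier K n →+ ZMod n, Function.Bijective log ∧
      ∀ (i : ℕ) (v : MuCarrier K n), muVal K n v = ζ ^ i → log v = i := by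
  let E : ZMod n ≃+ MuCarrier K n :=
    hζ.zmodEquivZPowers.trans
      ((MulEquiv.subgroupCongr hζ.zpowers_eq).toAdditive.trans MuCarrier.toAdditive.symm)
  have hE : ∀ i : ℕ, muVal K n (E i) = ζ ^ i := fun i ↦ by
    change muVal K n (MuCarrier.toAdditive.symm ((MulEquiv.subgroupCongr hζ.zpowers_eq).toAdditive
      (hζ.zmodEquivZPowers (i : ZMod n)))) = ζ ^ i
    rw [hζ.zmodEquivZPowers_apply_coe_nat]
    rfl
  refine ⟨E.symm, E.symm.bijective, fun i v hv ↦ ?_⟩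
  change E.symm v = i
  rw [AddEquiv.symm_apply_eq]
  exact muVal_injective K n (by rw [hv, hE])

/-- Every element of `μₙ(K̄)` is a power `ζ^i`, `i < n`, of a primitive root `ζ`. [cite: SerreGaloisCohomology1997, Ch. II §1.2] -/
theorem exists_muVal_eq_pow {ζ : (AlgebraicClosure K)ˣ} (hζ : IsPrimitiveRoot ζ n) (v : MuCarrier K n) :
    ∃ i < n, muVal K n v = ζ ^ i := by
  obtain ⟨i, hi, h⟩ := hζ.eq_pow_of_mem_rootsOfUnity ((MuCarrier.toAdditive v).toMul).2
  exact ⟨i, hi, h.symm⟩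

/-- **Equivariance of the discrete logarithm**: `log (σ • ξ) = χ̄(σ) · log ξ` for the mod-`p^k` cyclotomic
character `χ̄ = cyclotomicCharacterModPow K p k` (`σ ζ = ζ^{χ(σ)}`), for ANY additive `log` with `log (ζ^i) = i`.
[cite: SerreGaloisCohomology1997, Ch. II §1.2] -/
theorem muLog_equivariant_of_spec {p : ℕ} [Fact p.Prime] [NeZero (p : K)] {k : ℕ}
    {ζ : (AlgebraicClosure K)ˣ} (hζ : IsPrimitiveRoot ζ (p ^ k)) (log : MuCarrier K (p ^ k) →+ ZMod (p ^ k))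
    (hlog : ∀ (i : ℕ) (v : MuCarrier K (p ^ k)), muVal K (p ^ k) v = ζ ^ i → log v = i)
    (σ : absoluteGaloisGroup K) (v : MuCarrier K (p ^ k)) :
    log (mu K (p ^ k) σ v) = cyclotomicCharacterModPow K p k σ * log v := by
  haveI : NeZero (p ^ k) := ⟨pow_ne_zero k (Fact.out : p.Prime).ne_zero⟩
  obtain ⟨i, -, hi⟩ := exists_muVal_eq_pow K hζ v
  have hζ1 : ((ζ : (AlgebraicClosure K)ˣ) : AlgebraicClosure K) ^ p ^ k = 1 := by
    rw [← Units.val_pow_eq_pow_val, hζ.pow_eq_one, Units.val_one]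
  have hspec := GaloisRep.cyclotomicCharacter_spec K p (k := k) σ (ζ : AlgebraicClosure K) hζ1
  set c : ℕ := (cyclotomicCharacterModPow K p k σ).val with hc
  have hc' : ((GaloisRep.cyclotomicCharacter K p σ).val.toZModPow k).val = c := by
    rw [hc, cyclotomicCharacterModPow_apply]
  have hσζ : σ • (ζ : (AlgebraicClosure K)ˣ) = ζ ^ c := by
    ext
    rw [Units.coe_smul, hspec, hc', Units.val_pow_eq_pow_val]
  have hmu : muVal K (p ^ k) (mu K (p ^ k) σ v) = ζ ^ (c * i) := by
    rw [muVal_apply, hi, smul_pow', hσζ, ← pow_mul]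
  rw [hlog (c * i) _ hmu, hlog i v hi, Nat.cast_mul, hc, ZMod.natCast_zmod_val]

end OneLevel

/-! ## §3 The compatible family of discrete logarithms -/

section Family

variable (K : Type u) [Field K] (p : ℕ) [hp : Fact p.Prime]

/-- **Compatible discrete logarithms along the `p`-power tower.** For `p` invertible in `K` there are additive
bijections `log_k : μ_{p^k}(K̄) → ℤ/p^k` (`k ≥ 0`) such that
(i) `log_k (σ ξ) = χ̄_k(σ) · log_k ξ` for every `σ ∈ Γ_K` (`χ̄_k = cyclotomicCharacterModPow K p k`), and
(ii) whenever `ξ' ∈ μ_{p^k}` is the `p`-th power of `ξ ∈ μ_{p^{k+1}}` (as units of `K̄`),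
`log_k ξ' = (log_{k+1} ξ  mod p^k)` (`ZMod.castHom`).  (The logarithms to the base of a compatible system of
primitive roots `ζ_{k+1}^p = ζ_k`, i.e. of a generator of `ℤ_p(1)`.)
[cite: NeukirchSchmidtWingberg2008, (7.3.6)] [cite: SerreGaloisCohomology1997, Ch. II §1.2] -/
theorem exists_compatible_muLog (hpK : (p : K) ≠ 0) :
    ∃ log : (k : ℕ) → MuCarrier K (p ^ k) →+ ZMod (p ^ k),
      (∀ k, Function.Bijective (log k)) ∧
      (∀ (k : ℕ) (σ : absoluteGaloisGroup K) (v : MuCarrier K (p ^ k)),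
        log k (mu K (p ^ k) σ v) = cyclotomicCharacterModPow K p k σ * log k v) ∧
      (∀ (k : ℕ) (v : MuCarrier K (p ^ (k + 1))) (w : MuCarrier K (p ^ k)),
        muVal K (p ^ k) w = muVal K (p ^ (k + 1)) v ^ p →
          log k w = ZMod.castHom (pow_dvd_pow p k.le_succ) (ZMod (p ^ k)) (log (k + 1) v)) := by
  haveI : NeZero (p : K) := ⟨hpK⟩
  have hpp := hp.out
  have hpL : (p : AlgebraicClosure K) ≠ 0 := fun h ↦ hpK <| by
    apply (algebraMap K (AlgebraicClosure K)).injective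
    rw [map_natCast, map_zero, h]
  haveI hnz : ∀ k, NeZero (p ^ k) := fun k ↦ ⟨pow_ne_zero k hpp.ne_zero⟩
  obtain ⟨z, hzprim, hzp⟩ := exists_compatible_isPrimitiveRoot (L := AlgebraicClosure K) hpL
  -- the roots as units
  have hzunit : ∀ k, IsUnit (z k) := fun k ↦ (hzprim k).isUnit (pow_pos hpp.pos k).ne'
  let ζ : ℕ → (AlgebraicClosure K)ˣ := fun k ↦ (hzunit k).unit
  have hζval : ∀ k, ((ζ k : (AlgebraicClosure K)ˣ) : AlgebraicClosure K) = z k := fun k ↦ rfl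
  have hζprim : ∀ k, IsPrimitiveRoot (ζ k) (p ^ k) := fun k ↦
    IsPrimitiveRoot.coe_units_iff.mp (by rw [hζval]; exact hzprim k)
  have hζp : ∀ k, ζ (k + 1) ^ p = ζ k := fun k ↦ by
    ext; rw [Units.val_pow_eq_pow_val, hζval, hζval, hzp]
  choose log hbij hlog using fun k ↦ exists_muLog_of_isPrimitiveRoot K (hζprim k)
  refine ⟨log, hbij, fun k σ v ↦ muLog_equivariant_of_spec K (hζprim k) (log k) (hlog k) σ v,
    fun k v w hvw ↦ ?_⟩
  obtain ⟨i, -, hi⟩ := exists_muVal_eq_pow K (hζprim (k + 1)) v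
  have hw : muVal K (p ^ k) w = ζ k ^ i := by
    rw [hvw, hi, ← pow_mul, mul_comm, pow_mul, hζp]
  rw [hlog (k + 1) i v hi, hlog k i w hw, map_natCast]

end Family

end Literature.NumberTheory.GaloisRepresentations

end
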